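import Summits.QuantumFields.YangMills.Theorems.BalabanUVNodesN27AtSpineReadingOfRecord13CoPHVCut
import Summits.QuantumFields.YangMills.Theorems.BalabanUVNodesN21ShellSplitOfRecord13CoPHKeyed
import Summits.QuantumFields.YangMills.Theorems.BalabanUVNodesN20KeyedRelWeightCutZero
import Summits.QuantumFields.YangMills.Theorems.BalabanUVNodesN21KeyedShellWeightShellZero
import Literature.MathematicalPhysics.QuantumFieldTheory.Balaban1983to89.Node00.Record12MeasurabilityAbsolute

/-!
# BalabanUVNodes ∕ N27 = binder B5 AT THE RECORD — PRODUCER CURRENCIES AT THE v3 PIN: B5 ON THE LIVE LINE AT THE PER-TUPLE-CUT SPINE READING OF RECORD WITH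
# **dag-n21-d's SHELL SPLIT OF RECORD** `sh := shellSplitOfRecord₁₃At N K₀ ρA ρB` (N21 ⟸ the per-top-cube (M1) rows, p593341) AND∕OR **dag-n20-w2's ZERO CUT** `jc := 0` (N20 FREE, p590852)
# (cell `pub-ymgap`, HUMAN RULING D-0062 Track A, R134 seat `pub-ymgap-dag-n27-c` (N27 B5 composite, s2) gen 12, HOME trigger (t2) «a producer face at the spine reading in a NEW currency NOT
# knitted by its declarer ⇒ `_of_<antecedent>` storey»; K3⁷ `SpineGivenEndpointR13SepCoPH` = stmt-QuantumFields-20544 (plan g81 skeleton v3 02f6f498332fdbee: `PinnedAtLive jc sh cr`,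
# `crOfRecord₁₃V`, cut READ PER TUPLE); `--kind proof --supports 20544 --as helper`; COUNT-NEUTRAL; THEOREMS ONLY, 0 `def`, 0 `sorry`; `N`-generic, `K₀`-generic, regime-generic, NO Theses
# import — item faces in leaf `…N27SpineGivenEndpointR13SepCoPHShellSplitOfRecordV`)

WHY.  Module UC `…N27AtSpineReadingOfRecord13CoPHVCut` (this lineage, gen 12) asks the K5 side at `fun F θ hP g₀ os ↦ crOfRecord₁₃VAt K₀ (jc F θ hP g₀ os) sh F θ hP g₀ os` in WITNESS
form: `h20` = a keyed `RelWeightBound` witness (N20), `h21` = a keyed `ShellWeightBound` witness at the displayed split `sh` (N21), `h19` = a keyed `NE7.Core 1 (F.side ^ 4) … δ ∧ Summable δ`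
witness (N19′).  Two producer files now INHABIT two of these at named dials, in their own currencies, at ONE tuple each — neither knitted to B5 by its declarer:
* dag-n21-d p593341 `…N21ShellSplitOfRecord13CoPHKeyed` — `shellWeightBound_classSet₁₃_of_cubeAC` ∕ `…_crOfRecord₁₃At_shellSplit_of_liveSel`: AT THE SHELL SPLIT OF RECORD `shellSplitOfRecord₁₃At N K₀ ρA ρB`
  (`…Defs` p592363: `(shellA₁₃ … (ρA …), shellB₁₃ … (ρB …))`, width LETTERS `ρA ρB : WidthLetter₁₃CoPH N`) the keyed `ShellWeightBound` holds from the signs `0 ≤ ρ`, `0 ≤ D`, `Summable (D_K ρ_K)`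
  per run and THE estimate — per run, per `(K, t, top cube a)`, (M1) on the record's `a`-truncated dressed law — with (H-U), `0 ≤ ζ` displayed and F3's (e1) integrability a THEOREM on the
  live line (§6 `integrable_topPieceA∕B_of_liveSel`).  KEYED ⇒ it feeds the physical-volume reading through dag-n20-d's `shellWeightBound_crOfRecord₁₃VAt` unchanged.
* dag-n20-w2 p590852 `…N20KeyedRelWeightCutZero` — `relWeightBound_carriers₁₃_cutZero`: at the ZERO CUT `jcut := fun _ ↦ 0` the bad class is EMPTY and the keyed `RelWeightBound` holds
  with `W := 0`, unconditionally (LOCATED-1∕2∕3, plan g80∕g81 ruling (a): the dial is the prover's; at the zero cut the N19′ conjunct compares the two runs on EVERY keyed class).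
This file is the composer's instance: UC §3 (live line, `hsel` read off the regime) with `h21` REPLACED by n21-d's displayed rows at `sh := shellSplitOfRecord₁₃At N K₀ ρA ρB` and∕or `h20`
DISCHARGED at `jc := fun _ _ _ _ _ _ ↦ 0` (v3's `CutReading` constant zero); of n20-d's three extraction laws, (H-U) `LocalBgMeasurable` is node00-def-K0c's hypothesis-free THEOREM
`localBgMeasurable` (`Node00/Record12MeasurabilityAbsolute`) and `0 ≤ ζ` is n20-w2's `zeta_nonneg_of_provisos₁₃CoPH` (ζ-rows of the provisos) — both SUPPLIED here; only (H-ζ) `ZetaMeasurable θ.ζ` stays displayed.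

WHAT IS KERNEL-CHECKED ([bookkeeping]; each ONE application of UC §3 with the producer's theorem in the slot, per tuple).
* §1 ★★ `spine_rec13CCoPHOn_live_at_shellSplitOfRecord₁₃VAt_cut_of_keyedFacesP_cubeAC` — B5 at the record class of `G ∧ LiveSel` from: the law `hζm` ((H-U) and `0 ≤ ζ` are THEOREMS at the tuple: K0c `localBgMeasurable`, n20-w2 `zeta_nonneg_of_provisos₁₃CoPH`); N20 in witness form at the
  tuple's own cut depth (`h20`); **N21 ⟸ n21-d's rows** — width signs `hρA hρB` and, per tuple, `∃ DA DB ≥ 0` with `Summable (DA·ρA)`, `Summable (DB·ρB)` and the per-(run, K, t, top cube)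
  (M1) (`hM1`); ARBITRARY rates `P` at `rr` (`hrates`) and the N19′ edge from them to a summable-core witness at the shells OF RECORD (`h19`).
* §2 ★★ `spine_rec13CCoPHOn_live_of_homes₁₃CoPHOn_holder_at_shellSplitOfRecord₁₃VAt_cut_cubeAC` — the same with the K4 side as the five SENTENCES + `S_D4` at dag-n22-e's regime home
  `RRec₁₃CoPHOn 𝔯 (G ∧ LiveSel)` of ANY Stage-13 rate reading (R-β, N17 glued) and the N19′ edge reading `∀ k, RatesHolderAt … β`.
* §3 ★★ `spine_rec13CCoPHOn_live_at_crOfRecord₁₃VAt_cutZero_of_keyedFacesP` — ANY shell split `sh`, THE ZERO CUT: **N20 DISCHARGED** (n20-w2); N21 in witness form; the N19′ witness then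
  reads the bad class `badClass₁₃ θ K₀ g₀ (fun _ ↦ 0)` (= `∅`, n20-w2 `badClass₁₃_cutZero`: the core comparison on EVERY keyed class).
* §4 ★★★ `spine_rec13CCoPHOn_live_at_shellSplitOfRecord₁₃VAt_cutZero_of_keyedFacesP_cubeAC` — BOTH: at `(jc, sh) = (0, shellSplitOfRecord₁₃At N K₀ ρA ρB)` on the live line B5 costs
  EXACTLY: the laws, n21-d's (M1) rows, the rates `P`, and the N19′ core witness on every keyed class at the shells of record — N20 gone, N21 in its producer's deepest currency, N27x a theorem.
Consumed BY NAME: UC (gen 12); dag-n21-d `shellSplitOfRecord₁₃At ∕ WidthLetter₁₃CoPH ∕ shellA₁₃ ∕ shellB₁₃ ∕ shellPieceOfDatum₉ ∕ cubeWeightOfDatum₉` (p592363),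
`shellWeightBound_classSet₁₃_of_cubeAC ∕ integrable_topPieceA_of_liveSel ∕ integrable_topPieceB_of_liveSel` (p593341); dag-n20-w2 `relWeightBound_carriers₁₃_cutZero` (p590852);
dag-n20-d's reading and transfers (p590105 ∕ p587226).  Nothing landed is edited or re-declared.

HONEST FRAMING.  COMPOSITE-node bookkeeping BY NAME; NO estimate of Bałaban's asserted or used; (M1) per top cube is NOT PRINTED and NOT proved (n21-d's displayed estimate, carried
verbatim); the width letters `ρA ρB` are LETTERS (A6, n21-d: the zero width is the junk instance — content only jointly with N16's closeness widths and N19′'s core); the rates `P` ∕ K4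
sentences, the N20 witness (§1–§2), the N19′ witness and the laws are HYPOTHESES inhabited for no family today; no `Provisos₁₃CoPH` inhabitant claimed (K0⁷ open); the zero cut is ONE
setting of the prover's dial, booked nowhere as N20's discharge «at the policy the closing proof uses» (dag-lead's located content); NE7 ∕ NE7b ∕ NE7c NOT PRINTED for d = 4 and NOT
PROVED; N19 ∕ N20 ∕ N21 ∕ N27 NOT discharged (the chair books, R417); K3⁷ NOT claimed; skeleton v3 untouched; counts UNMOVED (typed 28∕28 · discharged 5∕27, A 5∕28); one finite
four-torus programme at fixed `ε` — NOT ℝ⁴, NOT infinite volume, NOT OS, NOT a mass gap, NOT Clay.  No decl below carries a cite tag.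
-/

set_option autoImplicit false

noncomputable section

namespace Summit.QuantumFields.YangMills.Theorems.BalabanUVNodesN27SpineRecord

open scoped BigOperators
open Finset MeasureTheory
open Literature.MathematicalPhysics.QuantumFieldTheory.Balaban1983to89
open Literature.MathematicalPhysics.QuantumFieldTheory.Balaban1983to89.T4Continuum
open Literature.MathematicalPhysics.QuantumFieldTheory.Balaban1983to89.Node00
open T4WeightBudget (RelWeightBound)
open T4IndicatorShell (ShellWeightBound)
open T4ContinuumYM4Torus (ForSmallCouplings)
open Summit.QuantumFields.BalabanUV.T4Continuum.Spine
open YMDAG.UVSplit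
open Summit.QuantumFields.YangMills.BalabanUVNodes.N19TargetClassWeightsE1Keyed
open Summit.QuantumFields.YangMills.BalabanUVNodes.N16HolderDefs (S_N16Holder)
open Summit.QuantumFields.YangMills.BalabanUVNodes.SpineRatesHolder (RatesHolderAt)
open Summit.QuantumFields.YangMills.Theorems.N21ShellSplitOfRecord13CoPH (WidthLetter₁₃CoPH shellSplitOfRecord₁₃At shellA₁₃ shellB₁₃ shellPieceOfDatum₉ cubeWeightOfDatum₉
  shellWeightBound_classSet₁₃_of_cubeAC integrable_topPieceA_of_liveSel integrable_topPieceB_of_liveSel)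
open Summit.QuantumFields.YangMills.BalabanUVNodes.N20KeyedRelWeightCutZero (relWeightBound_carriers₁₃_cutZero)
open Summit.QuantumFields.YangMills.BalabanUVNodes.N21KeyedShellWeightShellZero (shellWeightBound_carriers₁₃_shellZero zeta_nonneg_of_provisos₁₃CoPH)

variable {N : ℕ} [NeZero N] (K₀ : ℕ)
  (jc : (F : T4Family) → (θ : Stage13HParams F N) → θ.Provisos₁₃CoPH F N → (ℕ → ℝ) → List (ULoop F) → ℕ → ℕ)
  (ρA ρB : WidthLetter₁₃CoPH N) (G : (F : T4Family) → Stage13HParams F N → Prop)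

/-! ## §1 (P) on the live line AT THE SHELL SPLIT OF RECORD — N21 in dag-n21-d's (M1) currency -/

section KeyedP

variable (rr : (F : T4Family) → (θ : Stage13HParams F N) → θ.Provisos₁₃CoPH F N → (ℕ → ℝ) → List (ULoop F) → RateCarriers N)
  (P : ∀ {F : T4Family}, Datum F N → RateCarriers N → Prop)

/-- ★★ **B5 ON THE LIVE LINE OF A REGIME `G` AT `fun F θ hP g₀ os ↦ crOfRecord₁₃VAt K₀ (jc F θ hP g₀ os) (shellSplitOfRecord₁₃At N K₀ ρA ρB) F θ hP g₀ os`, N21 FROM dag-n21-d's ROWS**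
(UC §3 `spine_rec13CCoPHOn_live_at_crOfRecord₁₃VAt_cut_of_keyedFacesP` at `sh := shellSplitOfRecord₁₃At N K₀ ρA ρB`, with `h21 :=` n21-d's `shellWeightBound_classSet₁₃_of_cubeAC`, F3's
(e1) rows by `integrable_topPieceA∕B_of_liveSel` off the regime's selector pin, (H-U) by K0c's `localBgMeasurable`, `0 ≤ ζ` by n20-w2's `zeta_nonneg_of_provisos₁₃CoPH`): the law `hζm` (`ZetaMeasurable`, the ONE law not a theorem of the record); N20 as a keyed `RelWeightBound`
witness at the tuple's own cut depth; the width letters' signs `hρA hρB`; per tuple the (M1) data `hM1` — `∃ DA DB ≥ 0`, `Summable (DA_K·ρA_K)`, `Summable (DB_K·ρB_K)`, and per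
(run, K, |t| ≤ 1, top cube a) `Σ_s shellPiece ≤ (D_K ρ_K)·Σ_s cubeWeight` on the record's truncated dressed laws (NOT PRINTED, NOT proved: displayed); the rates `P` at `rr`
(`hrates`) and the N19′ edge from them to a summable `NE7.Core 1 (F.side ^ 4)` witness at the cores `weightA₁₃ − shellA₁₃ … (ρA …)`, `weightB₁₃ − shellB₁₃ … (ρB …)` (`h19`) ⇒
`Spine` at `IsRecordOfRecord₁₃CCoPHOn F N (G ∧ LiveSel)`.  Every displayed antecedent a HYPOTHESIS (0∕1 today). [bookkeeping] -/
theorem spine_rec13CCoPHOn_live_at_shellSplitOfRecord₁₃VAt_cut_of_keyedFacesP_cubeAC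
    (hζm : ∀ (F : T4Family) (θ : Stage13HParams F N), θ.Provisos₁₃CoPH F N →
      (G F θ ∧ θ.ppSel = ppSelLiveOfRecord F N θ.ν θ.τ9 (EOfRecord₁₃ F N θ.toStage13Params) (wOfRecord₉ F N θ.toStage9Params)) → θ.Admissible F N → ZetaMeasurable F N θ.ζ)
    (h20 : ∀ (F : T4Family) (θ : Stage13HParams F N) (hP : θ.Provisos₁₃CoPH F N),
      (G F θ ∧ θ.ppSel = ppSelLiveOfRecord F N θ.ν θ.τ9 (EOfRecord₁₃ F N θ.toStage13Params) (wOfRecord₉ F N θ.toStage9Params)) → θ.Admissible F N →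
        ∀ (g₀ : ℕ → ℝ) (os : List (ULoop F)),
          ∃ W : ℕ → ℝ, RelWeightBound 1 (classSet₁₃ θ K₀ g₀) (weightA₁₃ θ hP K₀ g₀ os) (weightB₁₃ θ hP K₀ g₀ os) (badClass₁₃ θ K₀ g₀ (jc F θ hP g₀ os)) W)
    (hρA : ∀ (F : T4Family) (θ : Stage13HParams F N) (hP : θ.Provisos₁₃CoPH F N),
      (G F θ ∧ θ.ppSel = ppSelLiveOfRecord F N θ.ν θ.τ9 (EOfRecord₁₃ F N θ.toStage13Params) (wOfRecord₉ F N θ.toStage9Params)) → θ.Admissible F N →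
        ∀ (g₀ : ℕ → ℝ) (os : List (ULoop F)) (K : ℕ), 0 ≤ ρA F θ hP g₀ os K)
    (hρB : ∀ (F : T4Family) (θ : Stage13HParams F N) (hP : θ.Provisos₁₃CoPH F N),
      (G F θ ∧ θ.ppSel = ppSelLiveOfRecord F N θ.ν θ.τ9 (EOfRecord₁₃ F N θ.toStage13Params) (wOfRecord₉ F N θ.toStage9Params)) → θ.Admissible F N →
        ∀ (g₀ : ℕ → ℝ) (os : List (ULoop F)) (K : ℕ), 0 ≤ ρB F θ hP g₀ os K)
    (hM1 : ∀ (F : T4Family) (θ : Stage13HParams F N) (hP : θ.Provisos₁₃CoPH F N),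
      (G F θ ∧ θ.ppSel = ppSelLiveOfRecord F N θ.ν θ.τ9 (EOfRecord₁₃ F N θ.toStage13Params) (wOfRecord₉ F N θ.toStage9Params)) → θ.Admissible F N →
        ∀ (g₀ : ℕ → ℝ) (os : List (ULoop F)), ∃ DA DB : ℕ → ℝ, (∀ K, 0 ≤ DA K) ∧ (∀ K, 0 ≤ DB K) ∧
          Summable (fun K => DA K * ρA F θ hP g₀ os K) ∧ Summable (fun K => DB K * ρB F θ hP g₀ os K) ∧
          (∀ (K : ℕ) (t : ℝ), |t| ≤ 1 →
            ∀ a : ↥(cubeIndices (F.P (K₀ + K)) (cubeSide (F.P (K₀ + K)).L θ.ν.M₂ (RkOfRecord (F.P (K₀ + K)).L θ.ν.r (histA₁₃ θ K₀ g₀ K (K₀ + K))) (K₀ + K))),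
              ∑ s, shellPieceOfDatum₉ F N θ.toStage9Params (datumOfRecord₁₃CoPH F N θ hP) g₀ os (runA₁₃ F K₀ g₀ K) (histA₁₃ θ K₀ g₀ K) (K₀ + K)
                  (ρA F θ hP g₀ os K) t a s ≤
                (DA K * ρA F θ hP g₀ os K) *
                  ∑ s, cubeWeightOfDatum₉ F N θ.toStage9Params (datumOfRecord₁₃CoPH F N θ hP) g₀ os (runA₁₃ F K₀ g₀ K) (histA₁₃ θ K₀ g₀ K) (K₀ + K) t a s) ∧
          (∀ (K : ℕ) (t : ℝ), |t| ≤ 1 →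
            ∀ a : ↥(cubeIndices (F.P (K₀ + K + 1)) (cubeSide (F.P (K₀ + K + 1)).L θ.ν.M₂
                (RkOfRecord (F.P (K₀ + K + 1)).L θ.ν.r (histB₁₃ θ K₀ g₀ K (K₀ + K + 1))) (K₀ + K + 1))),
              ∑ s', shellPieceOfDatum₉ F N θ.toStage9Params (datumOfRecord₁₃CoPH F N θ hP) g₀ os (runB₁₃ F K₀ g₀ K) (histB₁₃ θ K₀ g₀ K) (K₀ + K + 1)
                  (ρB F θ hP g₀ os K) t a s' ≤
                (DB K * ρB F θ hP g₀ os K) *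
                  ∑ s', cubeWeightOfDatum₉ F N θ.toStage9Params (datumOfRecord₁₃CoPH F N θ hP) g₀ os (runB₁₃ F K₀ g₀ K) (histB₁₃ θ K₀ g₀ K) (K₀ + K + 1) t a s'))
    (hrates : ∀ (F : T4Family) (θ : Stage13HParams F N) (hP : θ.Provisos₁₃CoPH F N),
      (G F θ ∧ θ.ppSel = ppSelLiveOfRecord F N θ.ν θ.τ9 (EOfRecord₁₃ F N θ.toStage13Params) (wOfRecord₉ F N θ.toStage9Params)) → θ.Admissible F N →
        ∀ (g₀ : ℕ → ℝ) (os : List (ULoop F)), P (datumOfRecord₁₃CoPH F N θ hP) (rr F θ hP g₀ os))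
    (h19 : ∀ (F : T4Family) (θ : Stage13HParams F N) (hP : θ.Provisos₁₃CoPH F N),
      (G F θ ∧ θ.ppSel = ppSelLiveOfRecord F N θ.ν θ.τ9 (EOfRecord₁₃ F N θ.toStage13Params) (wOfRecord₉ F N θ.toStage9Params)) → θ.Admissible F N →
        ∀ (g₀ : ℕ → ℝ) (os : List (ULoop F)), P (datumOfRecord₁₃CoPH F N θ hP) (rr F θ hP g₀ os) → letI : DecidableEq (Σ K, SiteSeqKey F (K₀ + K)) := Classical.decEq _
          ∃ δ : ℕ → ℝ, NE7.Core 1 (F.side ^ 4) (classSet₁₃ θ K₀ g₀) (badClass₁₃ θ K₀ g₀ (jc F θ hP g₀ os))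
            (fun K t x => weightA₁₃ θ hP K₀ g₀ os K t x - shellA₁₃ θ hP K₀ g₀ os (ρA F θ hP g₀ os) K t x)
            (fun K t x => weightB₁₃ θ hP K₀ g₀ os K t x - shellB₁₃ θ hP K₀ g₀ os (ρB F θ hP g₀ os) K t x) δ ∧ Summable δ) :
    Spine (N := N) fun F D w => Node00.IsRecordOfRecord₁₃CCoPHOn F N
      (fun F θ => G F θ ∧ θ.ppSel = ppSelLiveOfRecord F N θ.ν θ.τ9 (EOfRecord₁₃ F N θ.toStage13Params) (wOfRecord₉ F N θ.toStage9Params)) D w :=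
  spine_rec13CCoPHOn_live_at_crOfRecord₁₃VAt_cut_of_keyedFacesP K₀ jc (shellSplitOfRecord₁₃At N K₀ ρA ρB) G rr P
    (fun F θ _ _ _ => localBgMeasurable F N θ.ν) hζm (fun F θ hP _ _ => zeta_nonneg_of_provisos₁₃CoPH F θ hP) h20
    (fun F θ hP hRg hθ g₀ os => by
      obtain ⟨DA, DB, hDA, hDB, hsA, hsB, hM1A, hM1B⟩ := hM1 F θ hP hRg hθ g₀ os
      exact ⟨_, shellWeightBound_classSet₁₃_of_cubeAC K₀ θ hP g₀ os (localBgMeasurable F N θ.ν) (zeta_nonneg_of_provisos₁₃CoPH F θ hP)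
        (fun K t s => integrable_topPieceA_of_liveSel K₀ θ hP _ hRg.2 (localBgMeasurable F N θ.ν) (hζm F θ hP hRg hθ)
          (zeta_nonneg_of_provisos₁₃CoPH F θ hP) g₀ os K t s)
        (fun K t s' => integrable_topPieceB_of_liveSel K₀ θ hP _ hRg.2 (localBgMeasurable F N θ.ν) (hζm F θ hP hRg hθ)
          (zeta_nonneg_of_provisos₁₃CoPH F θ hP) g₀ os K t s')
        (hρA F θ hP hRg hθ g₀ os) hDA (hρB F θ hP hRg hθ g₀ os) hDB hsA hsB hM1A hM1B⟩)
    hrates h19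

end KeyedP

/-! ## §2 (Q) on the live line AT THE SHELL SPLIT OF RECORD — K4 as sentences at the regime home (R-β, N17 glued), N21 in the (M1) currency -/

section Homes

variable (β : ℝ) (𝔯 : RateReading₁₃CoPH N)

/-- ★★ **B5 ON THE LIVE LINE OF `G` FROM THE K4 SENTENCES AT `RRec₁₃CoPHOn 𝔯 (G ∧ LiveSel)` AND THE K5 SIDE AT THE PER-TUPLE-CUT READING WITH THE SHELL SPLIT OF RECORD, N21 FROM
dag-n21-d's ROWS** (UC §3 `spine_rec13CCoPHOn_live_of_homes₁₃CoPHOn_holder_at_crOfRecord₁₃VAt_cut` at `sh := shellSplitOfRecord₁₃At N K₀ ρA ρB`, `h21 :=` n21-d as in §1): the five producer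
sentences + (D4) on the live regime home, the laws, N20 as a keyed witness at the tuple's cut depth, the width signs, the (M1) data, and the N19′ edge reading `∀ k, RatesHolderAt … β` to a
summable-core witness at the shells of record ⇒ `Spine` at `IsRecordOfRecord₁₃CCoPHOn F N (G ∧ LiveSel)`.  Every displayed antecedent a HYPOTHESIS (0∕1 today); NE3 at exponent β and
(M1) NOT PROVED. [bookkeeping] -/
theorem spine_rec13CCoPHOn_live_of_homes₁₃CoPHOn_holder_at_shellSplitOfRecord₁₃VAt_cut_cubeAC
    (h14 : S_N14 (RRec₁₃CoPHOn 𝔯 fun F θ => G F θ ∧ θ.ppSel = ppSelLiveOfRecord F N θ.ν θ.τ9 (EOfRecord₁₃ F N θ.toStage13Params) (wOfRecord₉ F N θ.toStage9Params)))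
    (h15 : S_N15 (RRec₁₃CoPHOn 𝔯 fun F θ => G F θ ∧ θ.ppSel = ppSelLiveOfRecord F N θ.ν θ.τ9 (EOfRecord₁₃ F N θ.toStage13Params) (wOfRecord₉ F N θ.toStage9Params)))
    (h16 : S_N16Holder β (RRec₁₃CoPHOn 𝔯 fun F θ => G F θ ∧ θ.ppSel = ppSelLiveOfRecord F N θ.ν θ.τ9 (EOfRecord₁₃ F N θ.toStage13Params) (wOfRecord₉ F N θ.toStage9Params)))
    (h18 : S_N18 (RRec₁₃CoPHOn 𝔯 fun F θ => G F θ ∧ θ.ppSel = ppSelLiveOfRecord F N θ.ν θ.τ9 (EOfRecord₁₃ F N θ.toStage13Params) (wOfRecord₉ F N θ.toStage9Params)))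
    (h22 : S_N22 (RRec₁₃CoPHOn 𝔯 fun F θ => G F θ ∧ θ.ppSel = ppSelLiveOfRecord F N θ.ν θ.τ9 (EOfRecord₁₃ F N θ.toStage13Params) (wOfRecord₉ F N θ.toStage9Params)))
    (hD4 : S_D4 (RRec₁₃CoPHOn 𝔯 fun F θ => G F θ ∧ θ.ppSel = ppSelLiveOfRecord F N θ.ν θ.τ9 (EOfRecord₁₃ F N θ.toStage13Params) (wOfRecord₉ F N θ.toStage9Params)))
    (hζm : ∀ (F : T4Family) (θ : Stage13HParams F N), θ.Provisos₁₃CoPH F N →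
      (G F θ ∧ θ.ppSel = ppSelLiveOfRecord F N θ.ν θ.τ9 (EOfRecord₁₃ F N θ.toStage13Params) (wOfRecord₉ F N θ.toStage9Params)) → θ.Admissible F N → ZetaMeasurable F N θ.ζ)
    (h20 : ∀ (F : T4Family) (θ : Stage13HParams F N) (hP : θ.Provisos₁₃CoPH F N),
      (G F θ ∧ θ.ppSel = ppSelLiveOfRecord F N θ.ν θ.τ9 (EOfRecord₁₃ F N θ.toStage13Params) (wOfRecord₉ F N θ.toStage9Params)) → θ.Admissible F N →
        ∀ (g₀ : ℕ → ℝ) (os : List (ULoop F)),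
          ∃ W : ℕ → ℝ, RelWeightBound 1 (classSet₁₃ θ K₀ g₀) (weightA₁₃ θ hP K₀ g₀ os) (weightB₁₃ θ hP K₀ g₀ os) (badClass₁₃ θ K₀ g₀ (jc F θ hP g₀ os)) W)
    (hρA : ∀ (F : T4Family) (θ : Stage13HParams F N) (hP : θ.Provisos₁₃CoPH F N),
      (G F θ ∧ θ.ppSel = ppSelLiveOfRecord F N θ.ν θ.τ9 (EOfRecord₁₃ F N θ.toStage13Params) (wOfRecord₉ F N θ.toStage9Params)) → θ.Admissible F N →
        ∀ (g₀ : ℕ → ℝ) (os : List (ULoop F)) (K : ℕ), 0 ≤ ρA F θ hP g₀ os K)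
    (hρB : ∀ (F : T4Family) (θ : Stage13HParams F N) (hP : θ.Provisos₁₃CoPH F N),
      (G F θ ∧ θ.ppSel = ppSelLiveOfRecord F N θ.ν θ.τ9 (EOfRecord₁₃ F N θ.toStage13Params) (wOfRecord₉ F N θ.toStage9Params)) → θ.Admissible F N →
        ∀ (g₀ : ℕ → ℝ) (os : List (ULoop F)) (K : ℕ), 0 ≤ ρB F θ hP g₀ os K)
    (hM1 : ∀ (F : T4Family) (θ : Stage13HParams F N) (hP : θ.Provisos₁₃CoPH F N),
      (G F θ ∧ θ.ppSel = ppSelLiveOfRecord F N θ.ν θ.τ9 (EOfRecord₁₃ F N θ.toStage13Params) (wOfRecord₉ F N θ.toStage9Params)) → θ.Admissible F N →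
        ∀ (g₀ : ℕ → ℝ) (os : List (ULoop F)), ∃ DA DB : ℕ → ℝ, (∀ K, 0 ≤ DA K) ∧ (∀ K, 0 ≤ DB K) ∧
          Summable (fun K => DA K * ρA F θ hP g₀ os K) ∧ Summable (fun K => DB K * ρB F θ hP g₀ os K) ∧
          (∀ (K : ℕ) (t : ℝ), |t| ≤ 1 →
            ∀ a : ↥(cubeIndices (F.P (K₀ + K)) (cubeSide (F.P (K₀ + K)).L θ.ν.M₂ (RkOfRecord (F.P (K₀ + K)).L θ.ν.r (histA₁₃ θ K₀ g₀ K (K₀ + K))) (K₀ + K))),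
              ∑ s, shellPieceOfDatum₉ F N θ.toStage9Params (datumOfRecord₁₃CoPH F N θ hP) g₀ os (runA₁₃ F K₀ g₀ K) (histA₁₃ θ K₀ g₀ K) (K₀ + K)
                  (ρA F θ hP g₀ os K) t a s ≤
                (DA K * ρA F θ hP g₀ os K) *
                  ∑ s, cubeWeightOfDatum₉ F N θ.toStage9Params (datumOfRecord₁₃CoPH F N θ hP) g₀ os (runA₁₃ F K₀ g₀ K) (histA₁₃ θ K₀ g₀ K) (K₀ + K) t a s) ∧
          (∀ (K : ℕ) (t : ℝ), |t| ≤ 1 →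
            ∀ a : ↥(cubeIndices (F.P (K₀ + K + 1)) (cubeSide (F.P (K₀ + K + 1)).L θ.ν.M₂
                (RkOfRecord (F.P (K₀ + K + 1)).L θ.ν.r (histB₁₃ θ K₀ g₀ K (K₀ + K + 1))) (K₀ + K + 1))),
              ∑ s', shellPieceOfDatum₉ F N θ.toStage9Params (datumOfRecord₁₃CoPH F N θ hP) g₀ os (runB₁₃ F K₀ g₀ K) (histB₁₃ θ K₀ g₀ K) (K₀ + K + 1)
                  (ρB F θ hP g₀ os K) t a s' ≤
                (DB K * ρB F θ hP g₀ os K) *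
                  ∑ s', cubeWeightOfDatum₉ F N θ.toStage9Params (datumOfRecord₁₃CoPH F N θ hP) g₀ os (runB₁₃ F K₀ g₀ K) (histB₁₃ θ K₀ g₀ K) (K₀ + K + 1) t a s'))
    (h19 : ∀ (F : T4Family) (θ : Stage13HParams F N) (hP : θ.Provisos₁₃CoPH F N),
      (G F θ ∧ θ.ppSel = ppSelLiveOfRecord F N θ.ν θ.τ9 (EOfRecord₁₃ F N θ.toStage13Params) (wOfRecord₉ F N θ.toStage9Params)) → θ.Admissible F N →
        ∀ (g₀ : ℕ → ℝ) (os : List (ULoop F)),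
          (∀ k : ℕ, RatesHolderAt (datumOfRecord₁₃CoPH F N θ hP) (rateCarriersOfRecord₁₃CoPH 𝔯 F θ hP g₀ os k) β) →
            letI : DecidableEq (Σ K, SiteSeqKey F (K₀ + K)) := Classical.decEq _
            ∃ δ : ℕ → ℝ, NE7.Core 1 (F.side ^ 4) (classSet₁₃ θ K₀ g₀) (badClass₁₃ θ K₀ g₀ (jc F θ hP g₀ os))
              (fun K t x => weightA₁₃ θ hP K₀ g₀ os K t x - shellA₁₃ θ hP K₀ g₀ os (ρA F θ hP g₀ os) K t x)
              (fun K t x => weightB₁₃ θ hP K₀ g₀ os K t x - shellB₁₃ θ hP K₀ g₀ os (ρB F θ hP g₀ os) K t x) δ ∧ Summable δ) :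
    Spine (N := N) fun F D w => Node00.IsRecordOfRecord₁₃CCoPHOn F N
      (fun F θ => G F θ ∧ θ.ppSel = ppSelLiveOfRecord F N θ.ν θ.τ9 (EOfRecord₁₃ F N θ.toStage13Params) (wOfRecord₉ F N θ.toStage9Params)) D w :=
  spine_rec13CCoPHOn_live_of_homes₁₃CoPHOn_holder_at_crOfRecord₁₃VAt_cut K₀ jc (shellSplitOfRecord₁₃At N K₀ ρA ρB) G β 𝔯 h14 h15 h16 h18 h22 hD4
    (fun F θ _ _ _ => localBgMeasurable F N θ.ν) hζm (fun F θ hP _ _ => zeta_nonneg_of_provisos₁₃CoPH F θ hP) h20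
    (fun F θ hP hRg hθ g₀ os => by
      obtain ⟨DA, DB, hDA, hDB, hsA, hsB, hM1A, hM1B⟩ := hM1 F θ hP hRg hθ g₀ os
      exact ⟨_, shellWeightBound_classSet₁₃_of_cubeAC K₀ θ hP g₀ os (localBgMeasurable F N θ.ν) (zeta_nonneg_of_provisos₁₃CoPH F θ hP)
        (fun K t s => integrable_topPieceA_of_liveSel K₀ θ hP _ hRg.2 (localBgMeasurable F N θ.ν) (hζm F θ hP hRg hθ)
          (zeta_nonneg_of_provisos₁₃CoPH F θ hP) g₀ os K t s)
        (fun K t s' => integrable_topPieceB_of_liveSel K₀ θ hP _ hRg.2 (localBgMeasurable F N θ.ν) (hζm F θ hP hRg hθ)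
          (zeta_nonneg_of_provisos₁₃CoPH F θ hP) g₀ os K t s')
        (hρA F θ hP hRg hθ g₀ os) hDA (hρB F θ hP hRg hθ g₀ os) hDB hsA hsB hM1A hM1B⟩)
    h19

end Homes

/-! ## §3 (P) on the live line AT THE ZERO CUT `jc := 0` — N20 DISCHARGED by dag-n20-w2 (any shell split) -/

section CutZero

variable (sh : ShellSplit₁₃CoPH N K₀)
  (rr : (F : T4Family) → (θ : Stage13HParams F N) → θ.Provisos₁₃CoPH F N → (ℕ → ℝ) → List (ULoop F) → RateCarriers N)
  (P : ∀ {F : T4Family}, Datum F N → RateCarriers N → Prop)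

/-- ★★ **B5 ON THE LIVE LINE OF `G` AT THE ZERO CUT `fun F θ hP g₀ os ↦ crOfRecord₁₃VAt K₀ (fun _ ↦ 0) sh F θ hP g₀ os` — N20 DISCHARGED** (UC §3 at the constant cut reading
`fun _ _ _ _ _ _ ↦ 0` with `h20 := ⟨0, relWeightBound_carriers₁₃_cutZero F θ hP K₀ g₀ os⟩`, dag-n20-w2 p590852: the bad class `badClass₁₃ θ K₀ g₀ (fun _ ↦ 0)` is EMPTY): the laws,
N21 as a keyed `ShellWeightBound` witness at ANY displayed split `sh`, the rates `P` at `rr` and the N19′ edge from them to a summable `NE7.Core 1 (F.side ^ 4)` witness whose GOOD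
class is then ALL of `classSet₁₃` (n20-w2 `classSet₁₃_sdiff_badClass₁₃_cutZero`: the two runs compared on EVERY keyed class) ⇒ `Spine` at `IsRecordOfRecord₁₃CCoPHOn F N (G ∧ LiveSel)`.
One dial setting; N20's node discharge is booked at the policy the CLOSING proof uses, not here. [bookkeeping] -/
theorem spine_rec13CCoPHOn_live_at_crOfRecord₁₃VAt_cutZero_of_keyedFacesP
    (hζm : ∀ (F : T4Family) (θ : Stage13HParams F N), θ.Provisos₁₃CoPH F N →
      (G F θ ∧ θ.ppSel = ppSelLiveOfRecord F N θ.ν θ.τ9 (EOfRecord₁₃ F N θ.toStage13Params) (wOfRecord₉ F N θ.toStage9Params)) → θ.Admissible F N → ZetaMeasurable F N θ.ζ)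
    (h21 : ∀ (F : T4Family) (θ : Stage13HParams F N) (hP : θ.Provisos₁₃CoPH F N),
      (G F θ ∧ θ.ppSel = ppSelLiveOfRecord F N θ.ν θ.τ9 (EOfRecord₁₃ F N θ.toStage13Params) (wOfRecord₉ F N θ.toStage9Params)) → θ.Admissible F N →
        ∀ (g₀ : ℕ → ℝ) (os : List (ULoop F)),
          ∃ Wsh : ℕ → ℝ, ShellWeightBound 1 (classSet₁₃ θ K₀ g₀) (weightA₁₃ θ hP K₀ g₀ os) (weightB₁₃ θ hP K₀ g₀ os) (sh F θ hP g₀ os).1 (sh F θ hP g₀ os).2 Wsh)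
    (hrates : ∀ (F : T4Family) (θ : Stage13HParams F N) (hP : θ.Provisos₁₃CoPH F N),
      (G F θ ∧ θ.ppSel = ppSelLiveOfRecord F N θ.ν θ.τ9 (EOfRecord₁₃ F N θ.toStage13Params) (wOfRecord₉ F N θ.toStage9Params)) → θ.Admissible F N →
        ∀ (g₀ : ℕ → ℝ) (os : List (ULoop F)), P (datumOfRecord₁₃CoPH F N θ hP) (rr F θ hP g₀ os))
    (h19 : ∀ (F : T4Family) (θ : Stage13HParams F N) (hP : θ.Provisos₁₃CoPH F N),
      (G F θ ∧ θ.ppSel = ppSelLiveOfRecord F N θ.ν θ.τ9 (EOfRecord₁₃ F N θ.toStage13Params) (wOfRecord₉ F N θ.toStage9Params)) → θ.Admissible F N →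
        ∀ (g₀ : ℕ → ℝ) (os : List (ULoop F)), P (datumOfRecord₁₃CoPH F N θ hP) (rr F θ hP g₀ os) → letI : DecidableEq (Σ K, SiteSeqKey F (K₀ + K)) := Classical.decEq _
          ∃ δ : ℕ → ℝ, NE7.Core 1 (F.side ^ 4) (classSet₁₃ θ K₀ g₀) (badClass₁₃ θ K₀ g₀ (fun _ => 0)) (fun K t x => weightA₁₃ θ hP K₀ g₀ os K t x - (sh F θ hP g₀ os).1 K t x)
            (fun K t x => weightB₁₃ θ hP K₀ g₀ os K t x - (sh F θ hP g₀ os).2 K t x) δ ∧ Summable δ) :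
    Spine (N := N) fun F D w => Node00.IsRecordOfRecord₁₃CCoPHOn F N
      (fun F θ => G F θ ∧ θ.ppSel = ppSelLiveOfRecord F N θ.ν θ.τ9 (EOfRecord₁₃ F N θ.toStage13Params) (wOfRecord₉ F N θ.toStage9Params)) D w :=
  spine_rec13CCoPHOn_live_at_crOfRecord₁₃VAt_cut_of_keyedFacesP K₀ (fun _ _ _ _ _ _ => 0) sh G rr P
    (fun F θ _ _ _ => localBgMeasurable F N θ.ν) hζm (fun F θ hP _ _ => zeta_nonneg_of_provisos₁₃CoPH F θ hP)
    (fun F θ hP _ _ g₀ os => ⟨_, relWeightBound_carriers₁₃_cutZero F θ hP K₀ g₀ os⟩) h21 hrates h19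

/-! ## §4 (P) on the live line AT `(jc, sh) = (0, shellSplitOfRecord₁₃At N K₀ ρA ρB)` — N20 DISCHARGED, N21 in the (M1) currency: what B5 costs there BY NAME -/

/-- ★★★ **B5 ON THE LIVE LINE OF `G` AT THE ZERO CUT AND THE SHELL SPLIT OF RECORD — N20 GONE (dag-n20-w2), N21 ⟸ dag-n21-d's (M1) ROWS, N27x A THEOREM**: B5 at the record class of
`G ∧ LiveSel` from EXACTLY — the law `hζm`; the width letters' signs; per tuple the (M1) data (`∃ DA DB ≥ 0`, summable `D_K ρ_K`, per-(run, K, t, top cube) (M1)); the rates `P` at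
`rr`; and the N19′ edge from them to a summable `NE7.Core 1 (F.side ^ 4)` witness comparing the two runs' cores `weightA₁₃ − shellA₁₃ … (ρA …)` ∕ `weightB₁₃ − shellB₁₃ … (ρB …)` on EVERY
keyed class (bad class `badClass₁₃ θ K₀ g₀ (fun _ ↦ 0) = ∅`).  §1 at the constant zero cut reading with `h20 :=` n20-w2.  The irreducible two-run content of stub 2 at this dial is the
last binder (NE7 proper, NOT PRINTED for d = 4, NOT proved) — displayed, not claimed. [bookkeeping] -/
theorem spine_rec13CCoPHOn_live_at_shellSplitOfRecord₁₃VAt_cutZero_of_keyedFacesP_cubeAC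
    (hζm : ∀ (F : T4Family) (θ : Stage13HParams F N), θ.Provisos₁₃CoPH F N →
      (G F θ ∧ θ.ppSel = ppSelLiveOfRecord F N θ.ν θ.τ9 (EOfRecord₁₃ F N θ.toStage13Params) (wOfRecord₉ F N θ.toStage9Params)) → θ.Admissible F N → ZetaMeasurable F N θ.ζ)
    (hρA : ∀ (F : T4Family) (θ : Stage13HParams F N) (hP : θ.Provisos₁₃CoPH F N),
      (G F θ ∧ θ.ppSel = ppSelLiveOfRecord F N θ.ν θ.τ9 (EOfRecord₁₃ F N θ.toStage13Params) (wOfRecord₉ F N θ.toStage9Params)) → θ.Admissible F N →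
        ∀ (g₀ : ℕ → ℝ) (os : List (ULoop F)) (K : ℕ), 0 ≤ ρA F θ hP g₀ os K)
    (hρB : ∀ (F : T4Family) (θ : Stage13HParams F N) (hP : θ.Provisos₁₃CoPH F N),
      (G F θ ∧ θ.ppSel = ppSelLiveOfRecord F N θ.ν θ.τ9 (EOfRecord₁₃ F N θ.toStage13Params) (wOfRecord₉ F N θ.toStage9Params)) → θ.Admissible F N →
        ∀ (g₀ : ℕ → ℝ) (os : List (ULoop F)) (K : ℕ), 0 ≤ ρB F θ hP g₀ os K)
    (hM1 : ∀ (F : T4Family) (θ : Stage13HParams F N) (hP : θ.Provisos₁₃CoPH F N),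
      (G F θ ∧ θ.ppSel = ppSelLiveOfRecord F N θ.ν θ.τ9 (EOfRecord₁₃ F N θ.toStage13Params) (wOfRecord₉ F N θ.toStage9Params)) → θ.Admissible F N →
        ∀ (g₀ : ℕ → ℝ) (os : List (ULoop F)), ∃ DA DB : ℕ → ℝ, (∀ K, 0 ≤ DA K) ∧ (∀ K, 0 ≤ DB K) ∧
          Summable (fun K => DA K * ρA F θ hP g₀ os K) ∧ Summable (fun K => DB K * ρB F θ hP g₀ os K) ∧
          (∀ (K : ℕ) (t : ℝ), |t| ≤ 1 →
            ∀ a : ↥(cubeIndices (F.P (K₀ + K)) (cubeSide (F.P (K₀ + K)).L θ.ν.M₂ (RkOfRecord (F.P (K₀ + K)).L θ.ν.r (histA₁₃ θ K₀ g₀ K (K₀ + K))) (K₀ + K))),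
              ∑ s, shellPieceOfDatum₉ F N θ.toStage9Params (datumOfRecord₁₃CoPH F N θ hP) g₀ os (runA₁₃ F K₀ g₀ K) (histA₁₃ θ K₀ g₀ K) (K₀ + K)
                  (ρA F θ hP g₀ os K) t a s ≤
                (DA K * ρA F θ hP g₀ os K) *
                  ∑ s, cubeWeightOfDatum₉ F N θ.toStage9Params (datumOfRecord₁₃CoPH F N θ hP) g₀ os (runA₁₃ F K₀ g₀ K) (histA₁₃ θ K₀ g₀ K) (K₀ + K) t a s) ∧
          (∀ (K : ℕ) (t : ℝ), |t| ≤ 1 →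
            ∀ a : ↥(cubeIndices (F.P (K₀ + K + 1)) (cubeSide (F.P (K₀ + K + 1)).L θ.ν.M₂
                (RkOfRecord (F.P (K₀ + K + 1)).L θ.ν.r (histB₁₃ θ K₀ g₀ K (K₀ + K + 1))) (K₀ + K + 1))),
              ∑ s', shellPieceOfDatum₉ F N θ.toStage9Params (datumOfRecord₁₃CoPH F N θ hP) g₀ os (runB₁₃ F K₀ g₀ K) (histB₁₃ θ K₀ g₀ K) (K₀ + K + 1)
                  (ρB F θ hP g₀ os K) t a s' ≤
                (DB K * ρB F θ hP g₀ os K) *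
                  ∑ s', cubeWeightOfDatum₉ F N θ.toStage9Params (datumOfRecord₁₃CoPH F N θ hP) g₀ os (runB₁₃ F K₀ g₀ K) (histB₁₃ θ K₀ g₀ K) (K₀ + K + 1) t a s'))
    (hrates : ∀ (F : T4Family) (θ : Stage13HParams F N) (hP : θ.Provisos₁₃CoPH F N),
      (G F θ ∧ θ.ppSel = ppSelLiveOfRecord F N θ.ν θ.τ9 (EOfRecord₁₃ F N θ.toStage13Params) (wOfRecord₉ F N θ.toStage9Params)) → θ.Admissible F N →
        ∀ (g₀ : ℕ → ℝ) (os : List (ULoop F)), P (datumOfRecord₁₃CoPH F N θ hP) (rr F θ hP g₀ os))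
    (h19 : ∀ (F : T4Family) (θ : Stage13HParams F N) (hP : θ.Provisos₁₃CoPH F N),
      (G F θ ∧ θ.ppSel = ppSelLiveOfRecord F N θ.ν θ.τ9 (EOfRecord₁₃ F N θ.toStage13Params) (wOfRecord₉ F N θ.toStage9Params)) → θ.Admissible F N →
        ∀ (g₀ : ℕ → ℝ) (os : List (ULoop F)), P (datumOfRecord₁₃CoPH F N θ hP) (rr F θ hP g₀ os) → letI : DecidableEq (Σ K, SiteSeqKey F (K₀ + K)) := Classical.decEq _
          ∃ δ : ℕ → ℝ, NE7.Core 1 (F.side ^ 4) (classSet₁₃ θ K₀ g₀) (badClass₁₃ θ K₀ g₀ (fun _ => 0))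
            (fun K t x => weightA₁₃ θ hP K₀ g₀ os K t x - shellA₁₃ θ hP K₀ g₀ os (ρA F θ hP g₀ os) K t x)
            (fun K t x => weightB₁₃ θ hP K₀ g₀ os K t x - shellB₁₃ θ hP K₀ g₀ os (ρB F θ hP g₀ os) K t x) δ ∧ Summable δ) :
    Spine (N := N) fun F D w => Node00.IsRecordOfRecord₁₃CCoPHOn F N
      (fun F θ => G F θ ∧ θ.ppSel = ppSelLiveOfRecord F N θ.ν θ.τ9 (EOfRecord₁₃ F N θ.toStage13Params) (wOfRecord₉ F N θ.toStage9Params)) D w :=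
  spine_rec13CCoPHOn_live_at_shellSplitOfRecord₁₃VAt_cut_of_keyedFacesP_cubeAC K₀ (fun _ _ _ _ _ _ => 0) ρA ρB G rr P hζm
    (fun F θ hP _ _ g₀ os => ⟨_, relWeightBound_carriers₁₃_cutZero F θ hP K₀ g₀ os⟩) hρA hρB hM1 hrates h19

end CutZero

/-! ## §5 (P) on the live line AT THE ZERO DIAL `(jc, sh) = (0, 0)` — N20 AND N21 DISCHARGED (dag-n20-w2 p590852 ∕ p593923): what B5 costs there, BY NAME -/

section ZeroDial

variable (rr : (F : T4Family) → (θ : Stage13HParams F N) → θ.Provisos₁₃CoPH F N → (ℕ → ℝ) → List (ULoop F) → RateCarriers N)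
  (P : ∀ {F : T4Family}, Datum F N → RateCarriers N → Prop)

/-- ★★★ **B5 ON THE LIVE LINE OF `G` AT THE ZERO DIAL `fun F θ hP g₀ os ↦ crOfRecord₁₃VAt K₀ (fun _ ↦ 0) 0 F θ hP g₀ os` — N20 AND N21 BOTH DISCHARGED** (UC §3 at the constant zero cut
reading and the ZERO SHELL SPLIT `fun _ _ _ _ _ ↦ (0, 0)`, with `h20 := ⟨0, relWeightBound_carriers₁₃_cutZero …⟩` (dag-n20-w2 p590852) and `h21 := ⟨0, shellWeightBound_carriers₁₃_shellZero …⟩`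
(dag-n20-w2 p593923: keyed class weights of record ≥ 0 from the provisos' ζ-rows)): B5 at the record class of `G ∧ LiveSel` from EXACTLY — the law `hζm` ((H-U), `0 ≤ ζ` are theorems; ⇒ N27x, UC §0);
the rates `P` at `rr` (`hrates`); and the N19′ edge from them to a summable `NE7.Core 1 (F.side ^ 4)` witness comparing the two runs' FULL keyed class weights `weightA₁₃ ∕ weightB₁₃`
(no shell allowance) on EVERY keyed class (`badClass₁₃ θ K₀ g₀ (fun _ ↦ 0) = ∅`).  = dag-n20-w2's LOCATED-2 («what stub 2 costs at the cheapest dial») composed to B5: the last binder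
is ONE-STEP NE7 PROPER, term class by term class, NOT PRINTED for d = 4, NOT proved — displayed, not claimed; the dial setting books nothing for N20 ∕ N21 (plan ruling (a)). [bookkeeping] -/
theorem spine_rec13CCoPHOn_live_at_crOfRecord₁₃VAt_zeroDial_of_keyedFacesP
    (hζm : ∀ (F : T4Family) (θ : Stage13HParams F N), θ.Provisos₁₃CoPH F N →
      (G F θ ∧ θ.ppSel = ppSelLiveOfRecord F N θ.ν θ.τ9 (EOfRecord₁₃ F N θ.toStage13Params) (wOfRecord₉ F N θ.toStage9Params)) → θ.Admissible F N → ZetaMeasurable F N θ.ζ)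
    (hrates : ∀ (F : T4Family) (θ : Stage13HParams F N) (hP : θ.Provisos₁₃CoPH F N),
      (G F θ ∧ θ.ppSel = ppSelLiveOfRecord F N θ.ν θ.τ9 (EOfRecord₁₃ F N θ.toStage13Params) (wOfRecord₉ F N θ.toStage9Params)) → θ.Admissible F N →
        ∀ (g₀ : ℕ → ℝ) (os : List (ULoop F)), P (datumOfRecord₁₃CoPH F N θ hP) (rr F θ hP g₀ os))
    (h19 : ∀ (F : T4Family) (θ : Stage13HParams F N) (hP : θ.Provisos₁₃CoPH F N),
      (G F θ ∧ θ.ppSel = ppSelLiveOfRecord F N θ.ν θ.τ9 (EOfRecord₁₃ F N θ.toStage13Params) (wOfRecord₉ F N θ.toStage9Params)) → θ.Admissible F N →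
        ∀ (g₀ : ℕ → ℝ) (os : List (ULoop F)), P (datumOfRecord₁₃CoPH F N θ hP) (rr F θ hP g₀ os) → letI : DecidableEq (Σ K, SiteSeqKey F (K₀ + K)) := Classical.decEq _
          ∃ δ : ℕ → ℝ, NE7.Core 1 (F.side ^ 4) (classSet₁₃ θ K₀ g₀) (badClass₁₃ θ K₀ g₀ (fun _ => 0)) (weightA₁₃ θ hP K₀ g₀ os) (weightB₁₃ θ hP K₀ g₀ os) δ ∧ Summable δ) :
    Spine (N := N) fun F D w => Node00.IsRecordOfRecord₁₃CCoPHOn F N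
      (fun F θ => G F θ ∧ θ.ppSel = ppSelLiveOfRecord F N θ.ν θ.τ9 (EOfRecord₁₃ F N θ.toStage13Params) (wOfRecord₉ F N θ.toStage9Params)) D w :=
  spine_rec13CCoPHOn_live_at_crOfRecord₁₃VAt_cut_of_keyedFacesP K₀ (fun _ _ _ _ _ _ => 0) (fun _ _ _ _ _ => (fun _ _ _ => 0, fun _ _ _ => 0)) G rr P
    (fun F θ _ _ _ => localBgMeasurable F N θ.ν) hζm (fun F θ hP _ _ => zeta_nonneg_of_provisos₁₃CoPH F θ hP)
    (fun F θ hP _ _ g₀ os => ⟨_, relWeightBound_carriers₁₃_cutZero F θ hP K₀ g₀ os⟩)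
    (fun F θ hP _ _ g₀ os => ⟨_, shellWeightBound_carriers₁₃_shellZero F θ hP K₀ g₀ os⟩) hrates
    (fun F θ hP hRg hθ g₀ os hPr => by
      letI : DecidableEq (Σ K, SiteSeqKey F (K₀ + K)) := Classical.decEq _
      obtain ⟨δ, hδ, hsum⟩ := h19 F θ hP hRg hθ g₀ os hPr
      refine ⟨δ, ?_, hsum⟩
      simpa only [sub_zero] using hδ)

end ZeroDial

end Summit.QuantumFields.YangMills.Theorems.BalabanUVNodesN27SpineRecord

end
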